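import Mathlib
import HarnessLib.Audit
import Summits.PneNP.PneNP.Theorems.PstarChordReadBiLocal

/-!
# Coupled switch pairs: the base-reader split and the four-flip analysis (ROUND-24, O1 at exact tightness; memo g20 §13.10–13.11, residual R3)

FRONTIER range-avoidance ladder, rung F-N3, ROUND 24 (cell `pnp-ideate`, prover-2 memo `g20/O1-CHORD-READ-g20.md` §13.10 (β)/(γ); typed target
`PstarCoreBoundTargets.TerminalPeelable` (p646951); restricted-model proof complexity — nothing here bears on `P` versus `NP`).

Tools for the R3-pure capstone (`PstarChordReadCoupledGates`): two private gates `gᵢ = (pᵢ, zᵢ)`, `gⱼ = (pⱼ, zⱼ)` whose outside partners are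
COUPLED by a monomial `h = (zᵢ, zⱼ)`.

* `gval_erase_mono` — splitting one monomial off a reader (Boolean form of `PstarFreshErase.bit_gval_erase`);
* `doubleSliceGeneric_mono` — double-slice genericity descends to sub-menus;
* `biChordLocal_of_split` — if `Γ = Γ⁰ ⊕ Q` with `Γ⁰` bi-chord-local and `Q` a function of `(x_{pᵢ}, x_{pⱼ}, x_{zᵢ}, x_{zⱼ})` (`zᵢ, zⱼ` outside the
  core), then `Γ` is bi-chord-local;
* `four_flip` — the finite heart of memo §13.10 (β): with `Q(u,v) = A u ⊕ B v ⊕ ν uv` (`ν ≠ 0`), if two base pairs `δ, δ'` both avoid `0` under all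
  four `(u,v)`, then EITHER `A, B ∈ {0, ν}` (uniform) OR `δ = δ'` (the base pair is pinned);
* `uniform_type` — the finite step (γ): uniformity at the private patterns forces `λᵢ = λⱼ = ν` and `eᵢ, eⱼ ∈ {0, ν}`.

No Assumption A.
-/

set_option linter.dupNamespace false -- `Summit.PneNP.PneNP.…`: summit = sub-problem name (D-0017 single-conjunct layout)

open Finset Literature.Computability.Complexity
open Summit.PneNP.PneNP.Theorems.PstarFibrePolys (bit bit_injective bit_xor bit_and)
open Summit.PneNP.PneNP.Theorems.PstarSALevel (varSet bdry)
open Summit.PneNP.PneNP.Theorems.PstarGapOneAll (gval)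
open Summit.PneNP.PneNP.Theorems.PstarFreshErase (bit_gval_erase)
open Summit.PneNP.PneNP.Theorems.PstarChordReadBiLocal (BiChordLocal DoubleSliceGeneric)

namespace Summit.PneNP.PneNP.Theorems.PstarChordReadCoupledSplit

variable {n m : ℕ}

/-- **Splitting one monomial off a reader**: `gval C G = gval C (G ∖ g) ⊕ ([g ∈ G] ∧ x_{g₂} ∧ x_{g₃})`. -/
theorem gval_erase_mono (I : LocalMap 4 n m) (C : Finset (Fin n)) (G : Finset (Fin m)) (g : Fin m) (x : Fin n → Bool) :
    gval I C G x = xor (gval I C (G.erase g) x) (decide (g ∈ G) && (x (I.vars g 2) && x (I.vars g 3))) := by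
  classical
  by_cases hg : g ∈ G
  · apply bit_injective
    rw [bit_gval_erase I C hg x, bit_xor, decide_eq_true hg, Bool.true_and, bit_and]
  · rw [erase_eq_of_notMem hg, decide_eq_false hg, Bool.false_and, Bool.xor_false]

/-- **Double-slice genericity is inherited by sub-menus.** -/
theorem doubleSliceGeneric_mono {I : LocalMap 4 n m} {y : Fin m → Bool} {J₀ : Finset (Fin m)} {cᵢ cⱼ : Fin m} {𝒢 𝒢' : Finset (Fin m)}
    (h : 𝒢' ⊆ 𝒢) (hgen : DoubleSliceGeneric I y J₀ cᵢ cⱼ 𝒢) : DoubleSliceGeneric I y J₀ cᵢ cⱼ 𝒢' :=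
  fun C G tᵢ tⱼ b hpᵢ hqᵢ hpⱼ hqⱼ hG hfail => hgen C G tᵢ tⱼ b hpᵢ hqᵢ hpⱼ hqⱼ (hG.trans h) hfail

/-- **Bi-chord-locality through a split** `Γ = Γ⁰ ⊕ Q(x_{pᵢ}, x_{pⱼ}, x_{zᵢ}, x_{zⱼ})` with `zᵢ, zⱼ` outside the core. -/
theorem biChordLocal_of_split {I : LocalMap 4 n m} {J₀ : Finset (Fin m)} {cᵢ cⱼ : Fin m} {C C₀ : Finset (Fin n)} {G G₀ : Finset (Fin m)}
    {zᵢ zⱼ : Fin n} (hzᵢ : ∀ j ∈ J₀, zᵢ ∉ varSet I j) (hzⱼ : ∀ j ∈ J₀, zⱼ ∉ varSet I j) (Q : Bool → Bool → Bool → Bool → Bool)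
    (hsplit : ∀ x : Fin n → Bool, gval I C G x = xor (gval I C₀ G₀ x) (Q (x (I.vars cᵢ 2)) (x (I.vars cⱼ 2)) (x zᵢ) (x zⱼ)))
    (h₀ : BiChordLocal I J₀ cᵢ cⱼ C₀ G₀) : BiChordLocal I J₀ cᵢ cⱼ C G := by
  intro x x' hsᵢ hpᵢ hqᵢ hsⱼ hpⱼ hqⱼ hout
  rw [hsplit x, hsplit x', h₀ x x' hsᵢ hpᵢ hqᵢ hsⱼ hpⱼ hqⱼ hout, hpᵢ, hpⱼ, hout zᵢ hzᵢ, hout zⱼ hzⱼ]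

/-- The quadratic move of a coupled pair: `Q(u, v) = A u ⊕ B v ⊕ ν u v` in one coordinate. -/
def quad (A B ν u v : Bool) : Bool := xor (xor (A && u) (B && v)) (ν && (u && v))

/-- **FOUR-FLIP LEMMA** (memo §13.10 (β)).  `ν ≠ 0`; two base pairs `δ, δ'` both avoid `(0,0)` under all four moves `Q(u,v)`: then either the
coefficients are UNIFORM (`A, B ∈ {0, ν}`) or `δ = δ'`. -/
theorem four_flip (A₁ A₂ B₁ B₂ ν₁ ν₂ δ₁ δ₂ δ₁' δ₂' : Bool) (hν : (ν₁ || ν₂) = true)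
    (h : ∀ u v : Bool, ¬ (xor δ₁ (quad A₁ B₁ ν₁ u v) = false ∧ xor δ₂ (quad A₂ B₂ ν₂ u v) = false))
    (h' : ∀ u v : Bool, ¬ (xor δ₁' (quad A₁ B₁ ν₁ u v) = false ∧ xor δ₂' (quad A₂ B₂ ν₂ u v) = false)) :
    (((A₁ = false ∧ A₂ = false) ∨ (A₁ = ν₁ ∧ A₂ = ν₂)) ∧ ((B₁ = false ∧ B₂ = false) ∨ (B₁ = ν₁ ∧ B₂ = ν₂))) ∨
      (δ₁ = δ₁' ∧ δ₂ = δ₂') := by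
  have h00 := h false false; have h01 := h false true; have h10 := h true false; have h11 := h true true
  have k00 := h' false false; have k01 := h' false true; have k10 := h' true false; have k11 := h' true true
  clear h h'
  simp only [quad] at h00 h01 h10 h11 k00 k01 k10 k11
  cases A₁ <;> cases A₂ <;> cases B₁ <;> cases B₂ <;> cases ν₁ <;> cases ν₂ <;> cases δ₁ <;> cases δ₂ <;> cases δ₁' <;> cases δ₂' <;>
    simp_all

/-- **UNIFORM TYPE from uniform patterns** (memo §13.10 (γ)): if `e ⊕ (l ∧ s) ∈ {0, ν}` for `s = 0, 1` (both switches), with `l`'s and `ν`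
non-zero, then `lᵢ = lⱼ = ν` and `eᵢ, eⱼ ∈ {0, ν}`. -/
theorem uniform_type (e₁ᵢ e₂ᵢ l₁ᵢ l₂ᵢ e₁ⱼ e₂ⱼ l₁ⱼ l₂ⱼ ν₁ ν₂ : Bool) (hν : (ν₁ || ν₂) = true) (hlᵢ : (l₁ᵢ || l₂ᵢ) = true)
    (hlⱼ : (l₁ⱼ || l₂ⱼ) = true)
    (hA : ∀ s : Bool, (xor e₁ᵢ (l₁ᵢ && s) = false ∧ xor e₂ᵢ (l₂ᵢ && s) = false) ∨ (xor e₁ᵢ (l₁ᵢ && s) = ν₁ ∧ xor e₂ᵢ (l₂ᵢ && s) = ν₂))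
    (hB : ∀ t : Bool, (xor e₁ⱼ (l₁ⱼ && t) = false ∧ xor e₂ⱼ (l₂ⱼ && t) = false) ∨ (xor e₁ⱼ (l₁ⱼ && t) = ν₁ ∧ xor e₂ⱼ (l₂ⱼ && t) = ν₂)) :
    l₁ᵢ = ν₁ ∧ l₂ᵢ = ν₂ ∧ l₁ⱼ = ν₁ ∧ l₂ⱼ = ν₂ ∧ ((e₁ᵢ = false ∧ e₂ᵢ = false) ∨ (e₁ᵢ = ν₁ ∧ e₂ᵢ = ν₂)) ∧
      ((e₁ⱼ = false ∧ e₂ⱼ = false) ∨ (e₁ⱼ = ν₁ ∧ e₂ⱼ = ν₂)) := by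
  have a0 := hA false; have a1 := hA true; have b0 := hB false; have b1 := hB true
  clear hA hB
  cases e₁ᵢ <;> cases e₂ᵢ <;> cases l₁ᵢ <;> cases l₂ᵢ <;> cases e₁ⱼ <;> cases e₂ⱼ <;> cases l₁ⱼ <;> cases l₂ⱼ <;> cases ν₁ <;> cases ν₂ <;>
    simp_all

/-! ## Small helpers for the capstone (appended) -/

/-- `G₁ ∆ G₂ ⊆ G₁ ∪ G₂` (Finset form). -/
theorem symmDiff_subset_union_finset {m : ℕ} (G₁ G₂ : Finset (Fin m)) : symmDiff G₁ G₂ ⊆ G₁ ∪ G₂ := fun g hg => by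
  rcases Finset.mem_symmDiff.1 hg with ⟨h, -⟩ | ⟨h, -⟩
  · exact Finset.mem_union_left _ h
  · exact Finset.mem_union_right _ h

/-- The AND pair of a gate in canonical order. -/
theorem pair_and {I : LocalMap 4 n m} {g : Fin m} {v z : Fin n}
    (h : (I.vars g 2 = v ∧ I.vars g 3 = z) ∨ (I.vars g 2 = z ∧ I.vars g 3 = v)) (x : Fin n → Bool) :
    (x (I.vars g 2) && x (I.vars g 3)) = (x v && x z) := by
  rcases h with ⟨h2, h3⟩ | ⟨h2, h3⟩
  · rw [h2, h3]
  · rw [h2, h3, Bool.and_comm]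

/-- A flip that moves: `a' = a ⊕ M` with `M = true` gives `a' ≠ a`. -/
theorem ne_of_move {a a' M : Bool} (h : a' = xor a M) (hM : M = true) : a' ≠ a := by
  subst hM; rw [h]; cases a <;> decide

/-- The split polynomial of a coupled pair in `quad` form. -/
theorem Q_eq_quad (dh dgj dgi dzi dzj a b u v : Bool) :
    xor (dh && (u && v)) (xor (dgj && (b && v)) (xor (dgi && (a && u)) (xor (dzi && u) (dzj && v)))) =
      quad (xor dzi (dgi && a)) (xor dzj (dgj && b)) dh u v := by
  cases dh <;> cases dgj <;> cases dgi <;> cases dzi <;> cases dzj <;> cases a <;> cases b <;> cases u <;> cases v <;> decide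

end Summit.PneNP.PneNP.Theorems.PstarChordReadCoupledSplit
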